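import Mathlib
import Summits.Ventures.PercRepro2.CaseOneTwoMarkD
import Summits.Ventures.PercRepro2.HalfLTwoMarkMassesA
import Summits.Ventures.PercRepro2.HalfLA2BPoly

/-!
# The masses of the `L`-half for `a₃ ~ {a₂, b}` in the ten cells (blind cell PercRepro2, night-1 g37)

`a₃` adjacent exactly to the root `a₂` (edge `e₁`, weight `r₁`) and to `b` (edge `e₂`, weight `r₂`):
`CaseOne.IsTwoMarkAt ends a₂ b a₃ e₁ e₂` (p1's structure with `o := a₂`).  Base law `p[e₁ ↦ 0][e₂ ↦ 0]`,
base events `Q₀, O₁, O₂, B₁, B₂` and `OB = {o ↔ b}`; the ten cells `cells10Of` split `NN` by `OB`.  With `e₁`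
open `a₃` is a leaf at `a₂` (`a₃ ∈ H` on `Q₀`), with `e₂` open a leaf at `b`, with both open it joins `a₂`
and `b`: `Q` becomes `Q₀ ∩ {b ∉ L}` and `b`'s cluster (with `o` when `o ~ b`) joins `H`.  The ten masses
`mass_Q … mass_PDoU` are the polynomials of `HalfLA2BPoly` by `CaseOne.prob_twoPin`.
-/

namespace Summit.Ventures.PercRepro2

namespace HalfLA2B

open CaseOne HalfLTwoMark

section Cells

variable {V : Type*} {E : Type*} [Fintype E] [DecidableEq E] {R : Type*} [CommRing R]

/-- The ten cells of the base law `p[e₁ ↦ 0][e₂ ↦ 0]` (`NN` split by `o ↔ b`). -/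
noncomputable def cells10Of (p : E → R) (ends : E → Sym2 V) (o a₁ a₂ b : V) (e₁ e₂ : E) : Cells10 R where
  LL := prob (Function.update (Function.update p e₁ 0) e₂ 0)
    ((connEvent ends a₁ a₂)ᶜ ∩ connEvent ends a₁ o ∩ connEvent ends a₁ b)
  LH := prob (Function.update (Function.update p e₁ 0) e₂ 0)
    ((connEvent ends a₁ a₂)ᶜ ∩ connEvent ends a₁ o ∩ connEvent ends a₂ b)
  LN := prob (Function.update (Function.update p e₁ 0) e₂ 0)
    ((connEvent ends a₁ a₂)ᶜ ∩ connEvent ends a₁ o ∩ (connEvent ends a₁ b ∪ connEvent ends a₂ b)ᶜ)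
  HL := prob (Function.update (Function.update p e₁ 0) e₂ 0)
    ((connEvent ends a₁ a₂)ᶜ ∩ connEvent ends a₂ o ∩ connEvent ends a₁ b)
  HH := prob (Function.update (Function.update p e₁ 0) e₂ 0)
    ((connEvent ends a₁ a₂)ᶜ ∩ connEvent ends a₂ o ∩ connEvent ends a₂ b)
  HN := prob (Function.update (Function.update p e₁ 0) e₂ 0)
    ((connEvent ends a₁ a₂)ᶜ ∩ connEvent ends a₂ o ∩ (connEvent ends a₁ b ∪ connEvent ends a₂ b)ᶜ)
  NL := prob (Function.update (Function.update p e₁ 0) e₂ 0)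
    ((connEvent ends a₁ a₂)ᶜ ∩ (connEvent ends a₁ o ∪ connEvent ends a₂ o)ᶜ ∩ connEvent ends a₁ b)
  NH := prob (Function.update (Function.update p e₁ 0) e₂ 0)
    ((connEvent ends a₁ a₂)ᶜ ∩ (connEvent ends a₁ o ∪ connEvent ends a₂ o)ᶜ ∩ connEvent ends a₂ b)
  NNs := prob (Function.update (Function.update p e₁ 0) e₂ 0)
    ((connEvent ends a₁ a₂)ᶜ ∩ (connEvent ends a₁ o ∪ connEvent ends a₂ o)ᶜ ∩
      (connEvent ends a₁ b ∪ connEvent ends a₂ b)ᶜ ∩ connEvent ends o b)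
  NNd := prob (Function.update (Function.update p e₁ 0) e₂ 0)
    ((connEvent ends a₁ a₂)ᶜ ∩ (connEvent ends a₁ o ∪ connEvent ends a₂ o)ᶜ ∩
      (connEvent ends a₁ b ∪ connEvent ends a₂ b)ᶜ ∩ (connEvent ends o b)ᶜ)

/-- The `NN` split: `P(Q₀ ∩ Oc ∩ Bc) = NNs + NNd`. -/
lemma split_NN (p : E → R) (ends : E → Sym2 V) (o a₁ a₂ b : V) :
    prob p ((connEvent ends a₁ a₂)ᶜ ∩ (connEvent ends a₁ o ∪ connEvent ends a₂ o)ᶜ ∩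
        (connEvent ends a₁ b ∪ connEvent ends a₂ b)ᶜ) =
      prob p ((connEvent ends a₁ a₂)ᶜ ∩ (connEvent ends a₁ o ∪ connEvent ends a₂ o)ᶜ ∩
          (connEvent ends a₁ b ∪ connEvent ends a₂ b)ᶜ ∩ connEvent ends o b) +
        prob p ((connEvent ends a₁ a₂)ᶜ ∩ (connEvent ends a₁ o ∪ connEvent ends a₂ o)ᶜ ∩
          (connEvent ends a₁ b ∪ connEvent ends a₂ b)ᶜ ∩ (connEvent ends o b)ᶜ) :=
  (prob_inter_add_prob_inter_compl p _ _).symm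

/-- **The `o ↔ b` part of `Q₀ ∩ {b ∉ L} ∩ {o ∉ H}` is the cell `NNs`**: with `o ↔ b`, `o ∉ H` forces `b ∉ H`,
and `b ∉ L` forces `o ∉ L`. -/
lemma ob_cell (p : E → R) (ends : E → Sym2 V) (o a₁ a₂ b : V) :
    prob p ((connEvent ends a₁ a₂)ᶜ ∩ (connEvent ends a₁ b)ᶜ ∩ (connEvent ends a₂ o)ᶜ ∩ connEvent ends o b) =
      prob p ((connEvent ends a₁ a₂)ᶜ ∩ (connEvent ends a₁ o ∪ connEvent ends a₂ o)ᶜ ∩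
          (connEvent ends a₁ b ∪ connEvent ends a₂ b)ᶜ ∩ connEvent ends o b) := by
  apply prob_congr_set
  ext ω
  simp only [Set.mem_inter_iff, Set.mem_compl_iff, Set.mem_union, mem_connEvent, not_or]
  have t1 : Conn ends ω a₁ o → Conn ends ω o b → Conn ends ω a₁ b := fun x y => conn_trans x y
  have t2 : Conn ends ω a₂ b → Conn ends ω o b → Conn ends ω a₂ o := fun x y => conn_trans x (conn_symm y)
  tauto

end Cells

section Masses

variable {V : Type*} {E : Type*} [Fintype E] [DecidableEq E] {R : Type*} [CommRing R]
variable {ends : E → Sym2 V} {o a₃ b : V} {e₁ e₂ : E}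

/-- **`P(Q)`** for `a₃ ~ {a₂, b}`: `M − r₁ r₂ · P(Q₀, b ∈ L)`. -/
theorem mass_Q (p : E → R) {a₁ a₂ : V} (h : IsTwoMarkAt ends a₂ b a₃ e₁ e₂) (h1 : a₁ ≠ a₃) :
    prob p (connEvent ends a₁ a₂)ᶜ = mQ (p e₁) (p e₂) (cells10Of p ends o a₁ a₂ b e₁ e₂) := by
  set p00 := Function.update (Function.update p e₁ 0) e₂ 0 with hp00
  have h2 : a₂ ≠ a₃ := h.ne_o
  have key := prob_twoPin p h.ne (connEvent ends a₁ a₂)ᶜ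
    ((connEvent ends a₁ a₂)ᶜ ∩ (connEvent ends a₁ b)ᶜ)
    (connEvent ends a₁ a₂)ᶜ (connEvent ends a₁ a₂)ᶜ (connEvent ends a₁ a₂)ᶜ ?_ ?_ ?_ ?_
  · rw [key]
    unfold mQ cells10Of
    dsimp only
    rw [← hp00]
    have c := prob_inter_add_prob_inter_compl p00 (connEvent ends a₁ a₂)ᶜ (connEvent ends a₁ b)
    have so := split_o p00 ends o a₁ a₂ (connEvent ends a₁ b)
    have tot := total_cells p00 ends o b a₁ a₂
    have nn := split_NN p00 ends o a₁ a₂ b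
    linear_combination (p e₁ * p e₂) * (c - so) + tot + nn
  · intro ω ho hb
    rw [openCC_tt ho hb]
    simp only [Set.mem_compl_iff, Set.mem_inter_iff, mem_connEvent]
    rw [conn_both_iff h ω h1 h2, base2_eq_self ho hb, conn_comm_iff ω b a₂]
    have haa := conn_refl ends ω a₂
    tauto
  · intro ω ho hb
    rw [openCC_tf h.ne ho hb]
    simp only [Set.mem_compl_iff, mem_connEvent]
    rw [conn_open_o_iff h ω h1 h2, base2_eq_self ho hb]
  · intro ω ho hb
    rw [openCC_ft ho hb]
    simp only [Set.mem_compl_iff, mem_connEvent]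
    rw [conn_open_b_iff h ω h1 h2, base2_eq_self ho hb]
  · intro ω ho hb
    rw [openCC_ff ho hb, base2_eq_self ho hb]

/-- **`P(Q, b ∈ L)`** for `a₃ ~ {a₂, b}`: `(1 − r₁ r₂) · P(Q₀, b ∈ L)`. -/
theorem mass_bL (p : E → R) {a₁ a₂ : V} (h : IsTwoMarkAt ends a₂ b a₃ e₁ e₂) (h1 : a₁ ≠ a₃) :
    prob p ((connEvent ends a₁ a₂)ᶜ ∩ connEvent ends a₁ b) =
      mbL (p e₁) (p e₂) (cells10Of p ends o a₁ a₂ b e₁ e₂) := by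
  set p00 := Function.update (Function.update p e₁ 0) e₂ 0 with hp00
  have h2 : a₂ ≠ a₃ := h.ne_o
  have key := prob_twoPin p h.ne ((connEvent ends a₁ a₂)ᶜ ∩ connEvent ends a₁ b) ∅
    ((connEvent ends a₁ a₂)ᶜ ∩ connEvent ends a₁ b) ((connEvent ends a₁ a₂)ᶜ ∩ connEvent ends a₁ b)
    ((connEvent ends a₁ a₂)ᶜ ∩ connEvent ends a₁ b) ?_ ?_ ?_ ?_
  · rw [key]
    unfold mbL cells10Of
    dsimp only
    rw [← hp00, prob_empty]
    have so := split_o p00 ends o a₁ a₂ (connEvent ends a₁ b)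
    linear_combination (1 - p e₁ * p e₂) * so
  · intro ω ho hb
    rw [openCC_tt ho hb]
    simp only [Set.mem_compl_iff, Set.mem_inter_iff, mem_connEvent, Set.mem_empty_iff_false, iff_false]
    rw [conn_both_iff h ω h1 h2, conn_both_iff h ω h1 h.ne_b, base2_eq_self ho hb, conn_comm_iff ω b a₂]
    have haa := conn_refl ends ω a₂
    have hbb := conn_refl ends ω b
    tauto
  · intro ω ho hb
    rw [openCC_tf h.ne ho hb]
    simp only [Set.mem_compl_iff, Set.mem_inter_iff, mem_connEvent]
    rw [conn_open_o_iff h ω h1 h2, conn_open_o_iff h ω h1 h.ne_b, base2_eq_self ho hb]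
  · intro ω ho hb
    rw [openCC_ft ho hb]
    simp only [Set.mem_compl_iff, Set.mem_inter_iff, mem_connEvent]
    rw [conn_open_b_iff h ω h1 h2, conn_open_b_iff h ω h1 h.ne_b, base2_eq_self ho hb]
  · intro ω ho hb
    rw [openCC_ff ho hb, base2_eq_self ho hb]

/-- **`P(T)`** for `a₃ ~ {a₂, b}`. -/
theorem mass_T (p : E → R) {a₁ a₂ : V} (h : IsTwoMarkAt ends a₂ b a₃ e₁ e₂) (h1 : a₁ ≠ a₃) :
    prob p ((connEvent ends a₁ a₂)ᶜ ∩ connEvent ends a₂ a₃) =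
      mT (p e₁) (p e₂) (cells10Of p ends o a₁ a₂ b e₁ e₂) := by
  set p00 := Function.update (Function.update p e₁ 0) e₂ 0 with hp00
  have h2 : a₂ ≠ a₃ := h.ne_o
  have key := prob_twoPin p h.ne ((connEvent ends a₁ a₂)ᶜ ∩ connEvent ends a₂ a₃)
    ((connEvent ends a₁ a₂)ᶜ ∩ (connEvent ends a₁ b)ᶜ) (connEvent ends a₁ a₂)ᶜ
    ((connEvent ends a₁ a₂)ᶜ ∩ connEvent ends a₂ b) ∅ ?_ ?_ ?_ ?_
  · rw [key]
    unfold mT cells10Of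
    dsimp only
    rw [← hp00, prob_empty]
    have c := prob_inter_add_prob_inter_compl p00 (connEvent ends a₁ a₂)ᶜ (connEvent ends a₁ b)
    have so := split_o p00 ends o a₁ a₂ (connEvent ends a₁ b)
    have so2 := split_o p00 ends o a₁ a₂ (connEvent ends a₂ b)
    have tot := total_cells p00 ends o b a₁ a₂
    have nn := split_NN p00 ends o a₁ a₂ b
    linear_combination (p e₁ * p e₂) * (c - so) + ((1 - p e₁) * p e₂) * so2 + p e₁ * (tot + nn)
  · intro ω ho hb
    rw [openCC_tt ho hb]
    simp only [Set.mem_compl_iff, Set.mem_inter_iff, mem_connEvent]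
    rw [conn_both_iff h ω h1 h2, conn_both_a3_iff h ω h2, base2_eq_self ho hb, conn_comm_iff ω b a₂]
    have haa := conn_refl ends ω a₂
    tauto
  · intro ω ho hb
    rw [openCC_tf h.ne ho hb]
    simp only [Set.mem_compl_iff, Set.mem_inter_iff, mem_connEvent]
    rw [conn_open_o_iff h ω h1 h2, conn_open_o_a3_iff h ω h2, base2_eq_self ho hb]
    have haa := conn_refl ends ω a₂
    tauto
  · intro ω ho hb
    rw [openCC_ft ho hb]
    simp only [Set.mem_compl_iff, Set.mem_inter_iff, mem_connEvent]
    rw [conn_open_b_iff h ω h1 h2, conn_open_b_a3_iff h ω h2, base2_eq_self ho hb]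
  · intro ω ho hb
    rw [openCC_ff ho hb]
    simp only [Set.mem_compl_iff, Set.mem_inter_iff, mem_connEvent, Set.mem_empty_iff_false,
      iff_false, not_and]
    exact fun _ hc => not_conn_base2 h ω h2 hc

/-- **`P(T, b ∈ L)`** for `a₃ ~ {a₂, b}`: `r₁ (1 − r₂) · P(Q₀, b ∈ L)`. -/
theorem mass_TbL (p : E → R) {a₁ a₂ : V} (h : IsTwoMarkAt ends a₂ b a₃ e₁ e₂) (h1 : a₁ ≠ a₃) :
    prob p ((connEvent ends a₁ a₂)ᶜ ∩ connEvent ends a₂ a₃ ∩ connEvent ends a₁ b) =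
      mTbL (p e₁) (p e₂) (cells10Of p ends o a₁ a₂ b e₁ e₂) := by
  set p00 := Function.update (Function.update p e₁ 0) e₂ 0 with hp00
  have h2 : a₂ ≠ a₃ := h.ne_o
  have key := prob_twoPin p h.ne ((connEvent ends a₁ a₂)ᶜ ∩ connEvent ends a₂ a₃ ∩ connEvent ends a₁ b)
    ∅ ((connEvent ends a₁ a₂)ᶜ ∩ connEvent ends a₁ b) ∅ ∅ ?_ ?_ ?_ ?_
  · rw [key]
    unfold mTbL cells10Of
    dsimp only
    rw [← hp00, prob_empty]
    have so := split_o p00 ends o a₁ a₂ (connEvent ends a₁ b)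
    linear_combination (p e₁ * (1 - p e₂)) * so
  · intro ω ho hb
    rw [openCC_tt ho hb]
    simp only [Set.mem_compl_iff, Set.mem_inter_iff, mem_connEvent, Set.mem_empty_iff_false, iff_false]
    rw [conn_both_iff h ω h1 h2, conn_both_a3_iff h ω h2, conn_both_iff h ω h1 h.ne_b,
      base2_eq_self ho hb, conn_comm_iff ω b a₂]
    have haa := conn_refl ends ω a₂
    have hbb := conn_refl ends ω b
    tauto
  · intro ω ho hb
    rw [openCC_tf h.ne ho hb]
    simp only [Set.mem_compl_iff, Set.mem_inter_iff, mem_connEvent]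
    rw [conn_open_o_iff h ω h1 h2, conn_open_o_a3_iff h ω h2, conn_open_o_iff h ω h1 h.ne_b,
      base2_eq_self ho hb]
    have haa := conn_refl ends ω a₂
    tauto
  · intro ω ho hb
    rw [openCC_ft ho hb]
    simp only [Set.mem_compl_iff, Set.mem_inter_iff, mem_connEvent, Set.mem_empty_iff_false,
      iff_false]
    rw [conn_open_b_iff h ω h1 h2, conn_open_b_a3_iff h ω h2, conn_open_b_iff h ω h1 h.ne_b,
      base2_eq_self ho hb]
    exact fun hc => hc.1.1 (conn_trans hc.2 (conn_symm hc.1.2))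
  · intro ω ho hb
    rw [openCC_ff ho hb]
    simp only [Set.mem_compl_iff, Set.mem_inter_iff, mem_connEvent, Set.mem_empty_iff_false,
      iff_false]
    exact fun hc => not_conn_base2 h ω h2 hc.1.2

/-- **`P(T, b ∈ L, o ∈ U)`** for `a₃ ~ {a₂, b}`: `r₁ (1 − r₂) · P(Q₀, b ∈ L, o ∈ U)`. -/
theorem mass_TbLoU (p : E → R) {a₁ a₂ : V} (h : IsTwoMarkAt ends a₂ b a₃ e₁ e₂) (h1 : a₁ ≠ a₃)
    (ho3 : o ≠ a₃) :
    prob p ((connEvent ends a₁ a₂)ᶜ ∩ connEvent ends a₂ a₃ ∩ connEvent ends a₁ b ∩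
        (connEvent ends a₁ o ∪ connEvent ends a₂ o)) =
      mTbLoU (p e₁) (p e₂) (cells10Of p ends o a₁ a₂ b e₁ e₂) := by
  set p00 := Function.update (Function.update p e₁ 0) e₂ 0 with hp00
  have h2 : a₂ ≠ a₃ := h.ne_o
  have key := prob_twoPin p h.ne ((connEvent ends a₁ a₂)ᶜ ∩ connEvent ends a₂ a₃ ∩ connEvent ends a₁ b ∩
        (connEvent ends a₁ o ∪ connEvent ends a₂ o))
    ∅ (((connEvent ends a₁ a₂)ᶜ ∩ connEvent ends a₁ o ∩ connEvent ends a₁ b) ∪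
        ((connEvent ends a₁ a₂)ᶜ ∩ connEvent ends a₂ o ∩ connEvent ends a₁ b)) ∅ ∅ ?_ ?_ ?_ ?_
  · rw [key]
    unfold mTbLoU cells10Of
    dsimp only
    rw [← hp00, prob_empty]
    have d : Disjoint ((connEvent ends a₁ a₂)ᶜ ∩ connEvent ends a₁ o ∩ connEvent ends a₁ b)
        ((connEvent ends a₁ a₂)ᶜ ∩ connEvent ends a₂ o ∩ connEvent ends a₁ b) :=
      Set.disjoint_left.2 fun ω h1 h2 => not_both h1.1.1 h1.1.2 h2.1.2
    rw [prob_union_of_disjoint p00 d]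
    ring
  · intro ω ho hb
    rw [openCC_tt ho hb]
    simp only [Set.mem_compl_iff, Set.mem_inter_iff, Set.mem_union, mem_connEvent,
      Set.mem_empty_iff_false, iff_false]
    rw [conn_both_iff h ω h1 h2, conn_both_a3_iff h ω h2, conn_both_iff h ω h1 h.ne_b,
      conn_both_iff h ω h1 ho3, conn_both_iff h ω h2 ho3, base2_eq_self ho hb, conn_comm_iff ω b a₂]
    have haa := conn_refl ends ω a₂
    have hbb := conn_refl ends ω b
    tauto
  · intro ω ho hb
    rw [openCC_tf h.ne ho hb]
    simp only [Set.mem_compl_iff, Set.mem_inter_iff, Set.mem_union, mem_connEvent]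
    rw [conn_open_o_iff h ω h1 h2, conn_open_o_a3_iff h ω h2, conn_open_o_iff h ω h1 h.ne_b,
      conn_open_o_iff h ω h1 ho3, conn_open_o_iff h ω h2 ho3, base2_eq_self ho hb]
    have haa := conn_refl ends ω a₂
    tauto
  · intro ω ho hb
    rw [openCC_ft ho hb]
    simp only [Set.mem_compl_iff, Set.mem_inter_iff, Set.mem_union, mem_connEvent,
      Set.mem_empty_iff_false, iff_false]
    rw [conn_open_b_iff h ω h1 h2, conn_open_b_a3_iff h ω h2, conn_open_b_iff h ω h1 h.ne_b,
      base2_eq_self ho hb]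
    exact fun hc => hc.1.1.1 (conn_trans hc.1.2 (conn_symm hc.1.1.2))
  · intro ω ho hb
    rw [openCC_ff ho hb]
    simp only [Set.mem_compl_iff, Set.mem_inter_iff, Set.mem_union, mem_connEvent,
      Set.mem_empty_iff_false, iff_false]
    exact fun hc => not_conn_base2 h ω h2 hc.1.1.2


end Masses

end HalfLA2B

end Summit.Ventures.PercRepro2
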